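import Literature.AlgebraicGeometry.Frobenioids.PerfectionPullbackClasses
import Literature.AlgebraicGeometry.Frobenioids.PerfectionPreSteps
import Literature.AlgebraicGeometry.Frobenioids.PerfectionEquivalence
import Literature.AlgebraicGeometry.Frobenioids.PreFrobenioidPullbacks
import Literature.AlgebraicGeometry.Frobenioids.PreFrobenioidDataToFunctor
import Literature.AlgebraicGeometry.Frobenioids.EquivalenceUnitsTransport
import HarnessLib

/-!
# Frobenioids I, Proposition 3.2 (iii), "`C^pf` is a Frobenioid": Definition 1.3 (i)(a)(b)(c) for the
# perfection — surjectivity to the base category via pull-back morphisms (PROOFS)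

Mochizuki, *The geometry of Frobenioids I: the general theory*, Kyushu J. Math. **62** (2008)
293–400, Definition 1.3 (i) p. 24, Definition 3.1 (iii) p. 57, Proposition 3.2 (iii) p. 59
[cite: MochizukiFrdI2008, Prop. 3.2 (iii) p.59].  This file is the clause-group (i)(a), (i)(b), (i)(c) of
Def. 1.3 for THE perfection `Perfection hF` of a Frobenioid, at the level of the operations `Perfection.ops hF`
((i)(c) functor-level, for the structure functor `(Perfection.ops hF).toFunctor : C^pf → F_{Φ^pf}`)
(abc-iut cell, row `FrdI:Prop3.2(iii)-frobenioid`, carve-up v2; assembly in `PerfectionIsFrobenioid.lean`).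
No Frobenius-isotropic hypothesis is needed for these clauses.

* `isPullbackMorphism_toFunctor_mk_of` — the class of a pull-back representative is a pull-back morphism
  for `C^pf → F_{Φ^pf}` (functor-level reading of `isPullbackMorphism_mk_of`, seat abc-iut-w5-d246);
* `i_a_perfection` — the image `ι(A) = (A, 1)` of a Frobenius-trivial object of `C` is Frobenius-trivial
  (`ζ ↦ ι ∘ ζ`; `ι` preserves `deg_Fr`, base-identity endomorphisms and arrows of Frobenius type), and every
  object of `D` is the base of such an `A` (Def. 1.3 (i)(a) for `C`);
* `i_b_perfection` — a base isomorphism `Base(A, n) ≅ Base(B, m)` is `Base(ψ) ∘ Base(φ)⁻¹` for pre-steps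
  `φ : (X₀, n·m) → (A, n)`, `ψ : (X₀, n·m) → (B, m)` read off Def. 1.3 (i)(b) for `C` at `(A^{(m)}, B^{(n)})`;
* `i_c_perfection` — `(C^pf)^{pl-bk}_X → D_{Base X}` is an equivalence: faithful and full as for every
  pre-Frobenioid (`PreFrobenioidPullbacks.lean`), essentially surjective by Def. 1.3 (i)(c) for `C` at
  `A^{(1)}` and `isPullbackMorphism_mk_of` (seat abc-iut-w5-d246).

No new definitions; nothing here is specific to the abc programme.
-/

namespace Literature.AlgebraicGeometry.Frobenioids

namespace PreFrobenioid

namespace Perfection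

open CategoryTheory Opposite

universe w v v' u u'

variable {D : Type u} [Category.{v} D] {Φ : Dᵒᵖ ⥤ CommMonCat.{w}}
  {C : Type u'} [Category.{v'} C] {F : C ⥤ ElemFrobenioid Φ} {hF : IsFrobenioid F}

/-! ### Representatives at the degree-one power of the source: `X₀^{(1)} ≅ X₀ → A^{(a)}` -/

/-- `Base` of the class of a representative `X₀^{(1)} ⥲ X₀ → A^{(a)}` read through the isomorphism
`X₀ → X₀^{(1)}`: `Base(ψ₀) ≫ Base(frob_A)⁻¹`. [cite: MochizukiFrdI2008, Prop. 3.2 (i) p.58] -/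
theorem baseMap_inv_frob_comp {Z X : Perfection hF} {a : ℕ+} (h : Z.idx * 1 = X.idx * a)
    (ψ₀ : Z.obj ⟶ frobPow hF X.obj a) [IsIso (frob hF Z.obj 1)] :
    Rep.baseMap (⟨⟨1, a, h⟩, inv (frob hF Z.obj 1) ≫ ψ₀⟩ : Rep Z X) = Base F ψ₀ ≫ baseInvFrob hF X.obj a := by
  unfold Rep.baseMap
  change Base F (frob hF Z.obj 1) ≫ Base F (inv (frob hF Z.obj 1) ≫ ψ₀) ≫ baseInvFrob hF X.obj a = _
  rw [base_comp, ← Category.assoc, ← Category.assoc, ← base_comp, IsIso.hom_inv_id, base_id, Category.id_comp]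

/-- The class of `X₀^{(1)} ⥲ X₀ → A^{(a)}` is a pre-step of `C^pf` if `X₀ → A^{(a)}` is a pre-step of `C`.
[cite: MochizukiFrdI2008, Prop. 3.2 (ii) p.59] -/
theorem isPreStep_mk_inv_frob_comp {Z X : Perfection hF} {a : ℕ+} (h : Z.idx * 1 = X.idx * a)
    {ψ₀ : Z.obj ⟶ frobPow hF X.obj a} (hψ₀ : IsPreStep F ψ₀) [IsIso (frob hF Z.obj 1)] :
    (ops hF).IsPreStep (Hom.mk (⟨⟨1, a, h⟩, inv (frob hF Z.obj 1) ≫ ψ₀⟩ : Rep Z X)) :=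
  (isPreStep_mk_iff (⟨⟨1, a, h⟩, inv (frob hF Z.obj 1) ≫ ψ₀⟩ : Rep Z X)).mpr
    (IsPreStep.comp F (PreFrobenioid.isPreStep_of_isIso F _) hψ₀)

/-! ### Classes of pull-back representatives, functor-level -/

/-- The class of a representative that is a pull-back morphism of `C` is a pull-back morphism for the
structure functor `C^pf → F_{Φ^pf}` (functor-level form of `isPullbackMorphism_mk_of`, seat abc-iut-w5-d246,
through the interface/definition-file dictionary). [cite: MochizukiFrdI2008, Prop. 3.2 (ii) p.59] -/
theorem isPullbackMorphism_toFunctor_mk_of {Z X : Perfection hF} (a b : ℕ+) (hab : Z.idx * a = X.idx * b)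
    (ρ : frobPow hF Z.obj a ⟶ frobPow hF X.obj b) (hρ : PreFrobenioid.IsPullbackMorphism F ρ) :
    PreFrobenioid.IsPullbackMorphism (ops hF).toFunctor (Hom.mk (⟨⟨a, b, hab⟩, ρ⟩ : Rep Z X)) :=
  (PreFrobenioidData.ofFunctor_isPullbackMorphism (ops hF).toFunctor _).mp (isPullbackMorphism_mk_of a b hab ρ hρ)

/-! ### Definition 1.3 (i)(a) for `C^pf` -/

/-- The image `ι(A) = (A, 1)` of a Frobenius-trivial object of `C` is Frobenius-trivial in `C^pf`.
[cite: MochizukiFrdI2008, Prop. 3.2 (iii) p.59] -/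
theorem isFrobeniusTrivial_toPf_obj {A : C} (hA : IsFrobeniusTrivial F A) :
    (ops hF).IsFrobeniusTrivial ((toPf hF).obj A) := by
  obtain ⟨ζ, hζ⟩ := hA
  refine ⟨((toPf hF).mapEnd (X := A)).comp ζ, fun n => ⟨?_, ?_, ?_⟩⟩
  · change Hom.degFr ((toPf hF).map (ζ n)) = n
    rw [degFr_toPf]
    exact (hζ n).1
  · exact isBaseIdentity_toPf_map (hζ n).2.1
  · exact preservesMor_isFrobeniusType hF (ζ n)
      ((PreFrobenioidData.ofFunctor_isFrobeniusType F (ζ n)).mpr (hζ n).2.2)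

variable (hF) in
/-- **Def. 1.3 (i)(a) for `C^pf`**: every object of `D` is isomorphic to the base of a Frobenius-trivial object
of `C^pf` (namely `ι(A)` for a Frobenius-trivial `A` of `C` over it). [cite: MochizukiFrdI2008, Prop. 3.2 (iii) p.59] -/
theorem i_a_perfection (A₀ : D) :
    ∃ X : Perfection hF, (ops hF).IsFrobeniusTrivial X ∧ Nonempty ((ops hF).base.obj X ≅ A₀) := by
  obtain ⟨A, hA, ⟨i⟩⟩ := hF.i_a A₀
  exact ⟨(toPf hF).obj A, isFrobeniusTrivial_toPf_obj hA, ⟨i⟩⟩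

/-! ### Definition 1.3 (i)(b) for `C^pf` -/

variable (hF) in
/-- **Def. 1.3 (i)(b) for `C^pf`**: a base isomorphism `α : Base(A, n) ≅ Base(B, m)` is of the form
`Base(ψ) ∘ Base(φ)⁻¹` for pre-steps `φ : Z → (A, n)`, `ψ : Z → (B, m)` — from Def. 1.3 (i)(b) for `C` applied
to the conjugate isomorphism `Base(A^{(m)}) ≅ Base(B^{(n)})`, with `Z = (X₀, n·m)`.
[cite: MochizukiFrdI2008, Prop. 3.2 (iii) p.59] -/
theorem i_b_perfection (X Y : Perfection hF) (α : (ops hF).base.obj X ≅ (ops hF).base.obj Y) :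
    ∃ (Z : Perfection hF) (φ : Z ⟶ X) (ψ : Z ⟶ Y),
      (ops hF).IsPreStep φ ∧ (ops hF).IsPreStep ψ ∧ (ops hF).base.map φ ≫ α.hom = (ops hF).base.map ψ := by
  change (baseObj F X.obj ≅ baseObj F Y.obj) at α
  -- the conjugate base isomorphism `Base(A^{(m)}) ≅ Base(B^{(n)})`
  let α' : baseObj F (frobPow hF X.obj Y.idx) ≅ baseObj F (frobPow hF Y.obj X.idx) :=
    ⟨baseInvFrob hF X.obj Y.idx ≫ α.hom ≫ Base F (frob hF Y.obj X.idx),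
      baseInvFrob hF Y.obj X.idx ≫ α.inv ≫ Base F (frob hF X.obj Y.idx),
      by simp only [Category.assoc, base_frob_baseInvFrob_assoc, Iso.hom_inv_id_assoc, baseInvFrob_base_frob],
      by simp only [Category.assoc, base_frob_baseInvFrob_assoc, Iso.inv_hom_id_assoc, baseInvFrob_base_frob]⟩
  obtain ⟨X₀, φ₀, ψ₀, hφ₀, hψ₀, hαφψ⟩ := hF.i_b (frobPow hF X.obj Y.idx) (frobPow hF Y.obj X.idx) α'
  haveI := isIso_frob_one (hF := hF) X₀
  let Z : Perfection hF := ⟨X₀, X.idx * Y.idx⟩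
  have hZX : Z.idx * 1 = X.idx * Y.idx := mul_one _
  have hZY : Z.idx * 1 = Y.idx * X.idx := (mul_one _).trans (mul_comm _ _)
  refine ⟨Z, Hom.mk (⟨⟨1, Y.idx, hZX⟩, inv (frob hF X₀ 1) ≫ φ₀⟩ : Rep Z X),
    Hom.mk (⟨⟨1, X.idx, hZY⟩, inv (frob hF X₀ 1) ≫ ψ₀⟩ : Rep Z Y),
    isPreStep_mk_inv_frob_comp hZX hφ₀, isPreStep_mk_inv_frob_comp hZY hψ₀, ?_⟩
  change Rep.baseMap (⟨⟨1, Y.idx, hZX⟩, inv (frob hF X₀ 1) ≫ φ₀⟩ : Rep Z X) ≫ α.hom =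
    Rep.baseMap (⟨⟨1, X.idx, hZY⟩, inv (frob hF X₀ 1) ≫ ψ₀⟩ : Rep Z Y)
  rw [baseMap_inv_frob_comp hZX φ₀, baseMap_inv_frob_comp hZY ψ₀, ← hαφψ]
  change (Base F φ₀ ≫ baseInvFrob hF X.obj Y.idx) ≫ α.hom =
    (Base F φ₀ ≫ baseInvFrob hF X.obj Y.idx ≫ α.hom ≫ Base F (frob hF Y.obj X.idx)) ≫ baseInvFrob hF Y.obj X.idx
  simp only [Category.assoc, base_frob_baseInvFrob, Category.comp_id]

/-! ### Definition 1.3 (i)(c) for `C^pf` -/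

variable (hF) in
/-- **Def. 1.3 (i)(c) for `C^pf`** (functor-level, for `C^pf → F_{Φ^pf}`): `(C^pf)^{pl-bk}_X → D_{Base X}` is an
equivalence of categories — faithful and full as in every pre-Frobenioid, essentially surjective because a
pull-back morphism `X₀ → A^{(1)}` of `C` over a given `W → Base(A) ⥲ Base(A^{(1)})` (Def. 1.3 (i)(c) for
`C`) yields the pull-back morphism `(X₀, n) → (A, n)` of `C^pf` over `W → Base(A)`.
[cite: MochizukiFrdI2008, Prop. 3.2 (iii) p.59] -/
theorem i_c_perfection (X : Perfection hF) : (pullbackSliceToBase (ops hF).toFunctor X).IsEquivalence := by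
  haveI := pullbackSliceToBase_faithful (ops hF).toFunctor X
  haveI := pullbackSliceToBase_full (ops hF).toFunctor X
  refine { faithful := inferInstance, full := inferInstance, essSurj := ⟨fun W => ?_⟩ }
  haveI := hF.i_c (frobPow hF X.obj 1)
  -- `W.hom`, read as an arrow `W.left → Base(A)` of `D`
  let ω : W.left ⟶ baseObj F X.obj := W.hom
  obtain ⟨P, ⟨e⟩⟩ := Functor.EssSurj.mem_essImage (pullbackSliceToBase F (frobPow hF X.obj 1))
    (Over.mk (ω ≫ Base F (frob hF X.obj 1)))
  haveI : IsIso (frob hF (⟨P.left.obj, X.idx⟩ : Perfection hF).obj 1) := isIso_frob_one (hF := hF) P.left.obj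
  have hr : PreFrobenioid.IsPullbackMorphism (ops hF).toFunctor
      (Hom.mk (⟨⟨1, 1, rfl⟩, inv (frob hF P.left.obj 1) ≫ P.hom.1⟩ : Rep (⟨P.left.obj, X.idx⟩ : Perfection hF) X)) :=
    isPullbackMorphism_toFunctor_mk_of (Z := ⟨P.left.obj, X.idx⟩) (X := X) 1 1 rfl _
      (IsPullbackMorphism.comp F (isPullbackMorphism_of_isIso F _) P.hom.2)
  -- the base isomorphism `Base(X₀) ≅ W.left` over `Base(A^{(1)})`, read in `D`
  let el : baseObj F P.left.obj ≅ W.left := (Over.forget _).mapIso e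
  have hw : el.hom ≫ ω ≫ Base F (frob hF X.obj 1) = Base F P.hom.1 := Over.w e.hom
  have hb : Rep.baseMap (⟨⟨1, 1, rfl⟩, inv (frob hF P.left.obj 1) ≫ P.hom.1⟩ :
      Rep (⟨P.left.obj, X.idx⟩ : Perfection hF) X) = Base F P.hom.1 ≫ baseInvFrob hF X.obj 1 :=
    baseMap_inv_frob_comp (Z := ⟨P.left.obj, X.idx⟩) (X := X) rfl P.hom.1
  have key : el.hom ≫ ω =
      Rep.baseMap (⟨⟨1, 1, rfl⟩, inv (frob hF P.left.obj 1) ≫ P.hom.1⟩ :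
        Rep (⟨P.left.obj, X.idx⟩ : Perfection hF) X) := by
    rw [hb, ← hw]
    simp only [Category.assoc, base_frob_baseInvFrob, Category.comp_id]
  refine ⟨Over.mk (Y := ⟨⟨P.left.obj, X.idx⟩⟩) ⟨_, hr⟩, ⟨Over.isoMk el ?_⟩⟩
  exact key

end Perfection

end PreFrobenioid

end Literature.AlgebraicGeometry.Frobenioids
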